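import Literature.Geometry.GaugeTheory.SpincStructureGradNormSq
import Literature.Geometry.GaugeTheory.SeibergWittenAPrioriBound
import Literature.Geometry.GaugeTheory.AdaptedFramesCanonicalConnection
import HarnessLib

/-!
# The 1-form `Re⟨φ, ∇̃ψ⟩` of two spinor fields and the polarized Bochner identity
# `div Re⟨φ, ∇̃ψ⟩ = Σ_k Re⟨∇̃_{e_k}φ, ∇̃_{e_k}ψ⟩ - Re⟨φ, ∇_A^*∇_A ψ⟩`

Topic `Literature/Geometry/GaugeTheory`; the pointwise identity whose integral is the formal
self-adjointness `∫⟨φ, ∇_A^*∇_Aψ⟩ = ∫⟨∇_Aφ, ∇_Aψ⟩` of the connection Laplacian on a closed manifold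
(Morgan 1996, proof of Cor. 5.2.2 for `φ = ψ`; used throughout Taubes 1994, §§2–3: "take the inner
product of both sides with `β` and integrate ... after an integration by parts").  For a unitary
connection `A` on `det P̃` and smooth spinor fields `ψ`, `φ`:

* `covDerivPairingForm A ψ φ` — the real 1-form `v ↦ Re⟨φ, ∇̃_v ψ⟩` (hermitian pairing of `S(P̃)`,
  conjugate-linear in `φ`; well defined since the `G_ij` are unitary,
  `covDerivPairingForm_apply_of_mem`), smooth (`smoothAt_covDerivPairingForm`);
* **`sum_covDerivForm_covDerivPairingForm_eq`** — in the frame of a chart `U_i ∋ x`,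
  `Σ_k (e_k(θ(e_k)) - θ(∇_{e_k}e_k)) = Σ_k Re⟨∇̃_{e_k}φ, ∇̃_{e_k}ψ⟩ - Re⟨φ, ∇_A^*∇_Aψ⟩`,
  `θ = Re⟨φ, ∇̃ψ⟩`, `∇_A^*∇_A = -Σ_k(∇̃_{e_k}∇̃_{e_k} - ∇̃_{∇_{e_k}e_k})` (`localLaplacian`), by the
  Leibniz rule `e_k⟨φ, s⟩ = ⟨∇̃_{e_k}φ, s⟩ + ⟨φ, ∇̃_{e_k}s⟩` (`complexDeriv_spinorPairing_eq`,
  `∇̃` unitary).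

PROVED, 0 named facts.

## References

* J. W. Morgan, *The Seiberg–Witten Equations and Applications to the Topology of Smooth
  Four-Manifolds* (1996), §3.2 (3.2), Cor. 5.2.2 (proof). [MorganSWBook1996]
* C. H. Taubes, *The Seiberg–Witten invariants and symplectic forms*, Math. Res. Lett. 1 (1994)
  809–822, §2 (proof of Lemma 3), §3 (21). [Taubes1994]
-/

noncomputable section

open scoped Manifold ContDiff Topology Bundle ComplexConjugate Matrix
open Set Function Filter Bundle Complex
open Literature.Geometry.Lorentzian (PseudoRiemannianMetric contMDiffAt_clm_apply_iff)
open Literature.Topology.FourManifolds (SmoothOrientation)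

namespace Literature.Geometry.GaugeTheory

namespace SpincStructure

variable {X : Type*} [TopologicalSpace X] [ChartedSpace (EuclideanSpace ℝ (Fin 4)) X] [IsManifold (𝓡 4) ∞ X]
  {g : PseudoRiemannianMetric (𝓡 4) ∞ (EuclideanSpace ℝ (Fin 4)) (TangentSpace (𝓡 4) : X → Type _)}
  {o : SmoothOrientation (𝓡 4) X} {ι : Type*} (𝔰 : SpincStructure g o ι) [g.HasLeviCivita]

/-! ### Chart independence of the pairing `Re⟨φ_i, ∇̃_v ψ_i⟩` -/

/-- **`⟨φ_j, ∇̃_vψ_j⟩ = ⟨φ_i, ∇̃_vψ_i⟩` on `U_i ∩ U_j`** (`φ_i = G_ijφ_j`, `∇̃ψ_i = G_ij∇̃ψ_j`, `G_ij`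
unitary). [cite: MorganSWBook1996, §3.2 (3.2)] -/
theorem star_dotProduct_covDeriv_eq_of_mem_overlap (A : 𝔰.detLineBundle.Connection) {ψ : SpinorField 𝔰}
    (hψ : ψ.IsSmooth) (φ : SpinorField 𝔰) (i j : ι) {x : X} (hx : x ∈ 𝔰.baseSet i ∩ 𝔰.baseSet j)
    (v : TangentSpace (𝓡 4) x) :
    star (φ.toFun j x) ⬝ᵥ covDeriv A ψ j x v = star (φ.toFun i x) ⬝ᵥ covDeriv A ψ i x v := by
  rw [← 𝔰.mulVec_covDeriv_eq A hψ i j hx v, ← φ.mulVec_toFun i j x hx, Matrix.star_mulVec,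
    ← Matrix.dotProduct_mulVec, Matrix.mulVec_mulVec, 𝔰.conjTranspose_transition_mul_self i j hx.1 hx.2,
    Matrix.one_mulVec]

/-- **The real-linear map `v ↦ Re⟨φ_i(x), ∇̃_v ψ_i(x)⟩`** on `T_x X`. [cite: MorganSWBook1996, §3.2 (3.2)] -/
def covDerivPairingLin (A : 𝔰.detLineBundle.Connection) (ψ φ : SpinorField 𝔰) (i : ι) (x : X) :
    TangentSpace (𝓡 4) x →ₗ[ℝ] ℝ where
  toFun v := (star (φ.toFun i x) ⬝ᵥ covDeriv A ψ i x v).re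
  map_add' v w := by simp only [𝔰.covDeriv_add_vec, dotProduct_add, Complex.add_re]
  map_smul' c v := by
    rw [𝔰.covDeriv_smul_vec, dotProduct_smul, smul_eq_mul, Complex.re_ofReal_mul]
    rfl

/-- **The real 1-form `Re⟨φ, ∇̃ψ⟩`** of two spinor fields (read in the chart chosen at each point;
chart-independent by `star_dotProduct_covDeriv_eq_of_mem_overlap`). [cite: MorganSWBook1996, §3.2 (3.2)] -/
def covDerivPairingForm (A : 𝔰.detLineBundle.Connection) (ψ φ : SpinorField 𝔰) : RealOneForm X := fun x ↦
  haveI : T2Space (TangentSpace (𝓡 4) x) := inferInstanceAs (T2Space (EuclideanSpace ℝ (Fin 4)))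
  haveI : IsTopologicalAddGroup (TangentSpace (𝓡 4) x) := inferInstanceAs (IsTopologicalAddGroup (EuclideanSpace ℝ (Fin 4)))
  haveI : ContinuousSMul ℝ (TangentSpace (𝓡 4) x) := inferInstanceAs (ContinuousSMul ℝ (EuclideanSpace ℝ (Fin 4)))
  haveI : FiniteDimensional ℝ (TangentSpace (𝓡 4) x) := inferInstanceAs (FiniteDimensional ℝ (EuclideanSpace ℝ (Fin 4)))
  LinearMap.toContinuousLinearMap (𝔰.covDerivPairingLin A ψ φ (𝔰.indexAt x) x)

/-- Unfolding `covDerivPairingForm` (chart `indexAt x`). [folklore] -/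
theorem covDerivPairingForm_apply (A : 𝔰.detLineBundle.Connection) (ψ φ : SpinorField 𝔰) (x : X) (v : TangentSpace (𝓡 4) x) :
    𝔰.covDerivPairingForm A ψ φ x v = (star (φ.toFun (𝔰.indexAt x) x) ⬝ᵥ covDeriv A ψ (𝔰.indexAt x) x v).re :=
  rfl

/-- In any chart containing `x`: `Re⟨φ, ∇̃ψ⟩_x(v) = Re⟨φ_i(x), ∇̃_vψ_i(x)⟩`. [cite: MorganSWBook1996, §3.2 (3.2)] -/
theorem covDerivPairingForm_apply_of_mem (A : 𝔰.detLineBundle.Connection) {ψ : SpinorField 𝔰} (hψ : ψ.IsSmooth)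
    (φ : SpinorField 𝔰) {i : ι} {x : X} (hx : x ∈ 𝔰.baseSet i) (v : TangentSpace (𝓡 4) x) :
    𝔰.covDerivPairingForm A ψ φ x v = (star (φ.toFun i x) ⬝ᵥ covDeriv A ψ i x v).re := by
  rw [covDerivPairingForm_apply,
    𝔰.star_dotProduct_covDeriv_eq_of_mem_overlap A hψ φ i (𝔰.indexAt x) ⟨hx, 𝔰.mem_baseSet_indexAt x⟩ v]

/-! ### Smoothness -/

/-- **The components of `∇̃_W ψ_i` are smooth** at the points of the chart, for a smooth spinor field
and a field `W` smooth at the point. [cite: MorganSWBook1996, §3.2 (3.2)] -/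
theorem contMDiffAt_covDeriv_apply (A : 𝔰.detLineBundle.Connection) {ψ : SpinorField 𝔰} (hψ : ψ.IsSmooth)
    (i : ι) {x : X} (hx : x ∈ 𝔰.baseSet i) {W : Π y : X, TangentSpace (𝓡 4) y}
    (hW : ContMDiffAt (𝓡 4) ((𝓡 4).prod 𝓘(ℝ, EuclideanSpace ℝ (Fin 4))) ∞
      (fun y : X ↦ TotalSpace.mk' (EuclideanSpace ℝ (Fin 4)) (E := (TangentSpace (𝓡 4) : X → Type _)) y (W y)) x)
    (a : Spinor) :
    ContMDiffAt (𝓡 4) 𝓘(ℝ, ℂ) ∞ (fun y ↦ covDeriv A ψ i y (W y) a) x := by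
  have hnhds := (𝔰.isOpen_baseSet i).mem_nhds hx
  have hs : ∀ b, ContMDiffAt (𝓡 4) 𝓘(ℝ, ℂ) ∞ (fun y ↦ ψ.toFun i y b) x := fun b ↦ (hψ i b).contMDiffAt hnhds
  have hd : ContMDiffAt (𝓡 4) 𝓘(ℝ, ℂ) ∞ (fun y ↦ spinorDeriv (ψ.toFun i) y (W y) a) x :=
    contMDiffAt_complexDeriv_apply (hs a) hW
  have hm : ContMDiffAt (𝓡 4) 𝓘(ℝ, ℂ) ∞ (fun y ↦ (𝔰.connMatrix A i y (W y) *ᵥ ψ.toFun i y) a) x := by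
    have : (fun y ↦ (𝔰.connMatrix A i y (W y) *ᵥ ψ.toFun i y) a) =
        fun y ↦ ∑ b, 𝔰.connMatrix A i y (W y) a b * ψ.toFun i y b := by
      funext y
      rfl
    rw [this]
    exact ContMDiffAt.sum fun b _ ↦ ContMDiffAt.mul_complex (𝔰.contMDiffAt_connMatrix_apply_entry A hx hW a b) (hs b)
  have heq : (fun y ↦ covDeriv A ψ i y (W y) a) =
      fun y ↦ spinorDeriv (ψ.toFun i) y (W y) a + (𝔰.connMatrix A i y (W y) *ᵥ ψ.toFun i y) a := by
    funext y
    rw [𝔰.covDeriv_eq_localCovDeriv, localCovDeriv, Pi.add_apply]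
  rw [heq]
  exact hd.add hm

/-- **`y ↦ Re⟨φ_i(y), ∇̃_{W}ψ_i(y)⟩` is smooth** at the points of the chart, for smooth spinor fields and a
field `W` smooth at the point. [cite: MorganSWBook1996, §3.2 (3.2)] -/
theorem contMDiffAt_re_star_dotProduct_covDeriv (A : 𝔰.detLineBundle.Connection) {ψ φ : SpinorField 𝔰}
    (hψ : ψ.IsSmooth) (hφ : φ.IsSmooth) (i : ι) {x : X} (hx : x ∈ 𝔰.baseSet i) {W : Π y : X, TangentSpace (𝓡 4) y}
    (hW : ContMDiffAt (𝓡 4) ((𝓡 4).prod 𝓘(ℝ, EuclideanSpace ℝ (Fin 4))) ∞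
      (fun y : X ↦ TotalSpace.mk' (EuclideanSpace ℝ (Fin 4)) (E := (TangentSpace (𝓡 4) : X → Type _)) y (W y)) x) :
    ContMDiffAt (𝓡 4) 𝓘(ℝ, ℝ) ∞ (fun y ↦ (star (φ.toFun i y) ⬝ᵥ covDeriv A ψ i y (W y)).re) x := by
  have hnhds := (𝔰.isOpen_baseSet i).mem_nhds hx
  have ht : ∀ a, ContMDiffAt (𝓡 4) 𝓘(ℝ, ℂ) ∞ (fun y ↦ conj (φ.toFun i y a)) x := fun a ↦
    (Complex.conjCLE.contDiff.comp_contMDiffAt ((hφ i a).contMDiffAt hnhds))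
  have hsum : ContMDiffAt (𝓡 4) 𝓘(ℝ, ℂ) ∞ (fun y ↦ star (φ.toFun i y) ⬝ᵥ covDeriv A ψ i y (W y)) x := by
    change ContMDiffAt (𝓡 4) 𝓘(ℝ, ℂ) ∞ (fun y ↦ ∑ a, conj (φ.toFun i y a) * covDeriv A ψ i y (W y) a) x
    exact ContMDiffAt.sum fun a _ ↦ ContMDiffAt.mul_complex (ht a) (𝔰.contMDiffAt_covDeriv_apply A hψ i hx hW a)
  exact Complex.reCLM.contDiff.comp_contMDiffAt hsum

/-- **The covector field `w ↦ Re⟨φ, ∇̃_{e.symmL w}ψ⟩` is smooth at `x₀`.** [cite: MorganSWBook1996, §3.2 (3.2)] -/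
theorem contMDiffAt_covDerivPairingForm_comp_symmL (A : 𝔰.detLineBundle.Connection) {ψ φ : SpinorField 𝔰}
    (hψ : ψ.IsSmooth) (hφ : φ.IsSmooth) (x₀ : X) :
    ContMDiffAt (𝓡 4) 𝓘(ℝ, EuclideanSpace ℝ (Fin 4) →L[ℝ] ℝ) ∞ (fun x ↦ (𝔰.covDerivPairingForm A ψ φ x).comp
      ((trivializationAt (EuclideanSpace ℝ (Fin 4)) (TangentSpace (𝓡 4) : X → Type _) x₀).symmL ℝ x)) x₀ := by
  rw [contMDiffAt_clm_apply_iff]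
  intro w
  have hi := 𝔰.mem_baseSet_indexAt x₀
  have h := 𝔰.contMDiffAt_re_star_dotProduct_covDeriv A hψ hφ (𝔰.indexAt x₀) hi (contMDiffAt_symmL_trivializationAt x₀ w)
  refine h.congr_of_eventuallyEq ?_
  filter_upwards [(𝔰.isOpen_baseSet (𝔰.indexAt x₀)).mem_nhds hi] with x hx
  exact 𝔰.covDerivPairingForm_apply_of_mem A hψ φ hx _

/-- **`Re⟨φ, ∇̃ψ⟩` is a smooth 1-form** for smooth spinor fields. [cite: MorganSWBook1996, §3.2 (3.2)] -/
theorem smoothAt_covDerivPairingForm (A : 𝔰.detLineBundle.Connection) {ψ φ : SpinorField 𝔰}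
    (hψ : ψ.IsSmooth) (hφ : φ.IsSmooth) (x₀ : X) : (𝔰.covDerivPairingForm A ψ φ).SmoothAt x₀ := by
  obtain ⟨F, hF⟩ : ∃ F : X → EuclideanSpace ℝ (Fin 4) →L[ℝ] ℝ, F = fun x ↦ (𝔰.covDerivPairingForm A ψ φ x).comp
      ((trivializationAt (EuclideanSpace ℝ (Fin 4)) (TangentSpace (𝓡 4) : X → Type _) x₀).symmL ℝ x) := ⟨_, rfl⟩
  have hFs : ContMDiffAt (𝓡 4) 𝓘(ℝ, EuclideanSpace ℝ (Fin 4) →L[ℝ] ℝ) ∞ F x₀ :=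
    hF ▸ 𝔰.contMDiffAt_covDerivPairingForm_comp_symmL A hψ hφ x₀
  have hG : ContMDiffAt (𝓡 4) 𝓘(ℝ, (EuclideanSpace ℝ (Fin 4)) [⋀^Fin 1]→L[ℝ] ℝ) ∞
      ((fun L : EuclideanSpace ℝ (Fin 4) →L[ℝ] ℝ ↦
        ContinuousAlternatingMap.ofSubsingleton ℝ (EuclideanSpace ℝ (Fin 4)) ℝ (0 : Fin 1) L) ∘ F) x₀ :=
    (ContinuousAlternatingMap.ofSubsingletonLIE (𝕜 := ℝ) (E := EuclideanSpace ℝ (Fin 4)) (F := ℝ)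
      (0 : Fin 1)).toContinuousLinearEquiv.contDiff.comp_contMDiffAt hFs
  have hG' : ContDiffWithinAt ℝ ∞
      (((fun L : EuclideanSpace ℝ (Fin 4) →L[ℝ] ℝ ↦
        ContinuousAlternatingMap.ofSubsingleton ℝ (EuclideanSpace ℝ (Fin 4)) ℝ (0 : Fin 1) L) ∘ F) ∘
        (extChartAt (𝓡 4) x₀).symm) (range (𝓡 4)) (extChartAt (𝓡 4) x₀ x₀) := by
    simpa using (contMDiffAt_iff.1 hG).2
  have hev : ∀ y ∈ (extChartAt (𝓡 4) x₀).target, (𝔰.covDerivPairingForm A ψ φ).toMForm.inChart x₀ y =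
      ContinuousAlternatingMap.ofSubsingleton ℝ (EuclideanSpace ℝ (Fin 4)) ℝ (0 : Fin 1) (F ((extChartAt (𝓡 4) x₀).symm y)) := by
    intro y hy
    have hx : (extChartAt (𝓡 4) x₀).symm y ∈ (chartAt (EuclideanSpace ℝ (Fin 4)) x₀).source := by
      rw [← extChartAt_source (𝓡 4)]
      exact (extChartAt (𝓡 4) x₀).map_target hy
    have hD : mfderivWithin 𝓘(ℝ, EuclideanSpace ℝ (Fin 4)) (𝓡 4) (extChartAt (𝓡 4) x₀).symm (range (𝓡 4)) y =
        (trivializationAt (EuclideanSpace ℝ (Fin 4)) (TangentSpace (𝓡 4) : X → Type _) x₀).symmL ℝ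
          ((extChartAt (𝓡 4) x₀).symm y) := by
      rw [TangentBundle.symmL_trivializationAt hx, (extChartAt (𝓡 4) x₀).right_inv hy]
    ext v
    rw [Literature.Geometry.Kaehler.MForm.inChart_apply, hD, ContinuousAlternatingMap.ofSubsingleton_apply_apply]
    simp only [hF, RealOneForm.toMForm_apply, ContinuousLinearMap.comp_apply]
    rfl
  unfold RealOneForm.SmoothAt
  refine hG'.congr_of_eventuallyEq ?_ (hev _ (mem_extChartAt_target x₀))
  filter_upwards [extChartAt_target_mem_nhdsWithin x₀] with y hy using hev y hy

/-! ### The polarized Bochner identity -/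

omit [IsManifold (𝓡 4) ∞ X] in
/-- The derivative of the real part is the real part of the derivative. [folklore] -/
theorem _root_.Literature.Geometry.GaugeTheory.mvfderiv_re_eq {P : X → ℂ} {x : X} (hP : MDifferentiableAt (𝓡 4) 𝓘(ℝ, ℂ) P x) (v : TangentSpace (𝓡 4) x) :
    mvfderiv (𝓡 4) (fun y ↦ (P y).re) x v = (complexDeriv P x v).re := by
  have hre : HasMFDerivAt (𝓡 4) 𝓘(ℝ, ℝ) (fun y ↦ (P y).re) x
      ((Complex.reCLM : ℂ →L[ℝ] ℝ).comp (mfderiv (𝓡 4) 𝓘(ℝ, ℂ) P x)) :=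
    (Complex.reCLM.hasMFDerivAt (x := P x)).comp x hP.hasMFDerivAt
  unfold mvfderiv
  rw [hre.mfderiv]
  rfl

/-- **The polarized Bochner identity** in the frame of a chart `U_i ∋ x`, for smooth spinor fields
`ψ`, `φ` and the 1-form `θ = Re⟨φ, ∇̃ψ⟩`:
`Σ_k (e_k(θ(e_k)) - θ(∇_{e_k}e_k)) = Σ_k Re⟨∇̃_{e_k}φ, ∇̃_{e_k}ψ⟩ - Re⟨φ, ∇_A^*∇_Aψ⟩`
(Leibniz `e_k⟨φ, ∇̃_{e_k}ψ⟩ = ⟨∇̃_{e_k}φ, ∇̃_{e_k}ψ⟩ + ⟨φ, ∇̃_{e_k}∇̃_{e_k}ψ⟩`,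
`∇_A^*∇_A = -Σ_k(∇̃_{e_k}∇̃_{e_k} - ∇̃_{∇_{e_k}e_k})`). [cite: MorganSWBook1996, Cor. 5.2.2 (proof)] -/
theorem sum_covDerivForm_covDerivPairingForm_eq (A : 𝔰.detLineBundle.Connection) {ψ φ : SpinorField 𝔰}
    (hψ : ψ.IsSmooth) (hφ : φ.IsSmooth) (i : ι) {x : X} (hx : x ∈ 𝔰.baseSet i) :
    ∑ k, (mvfderiv (𝓡 4) (fun y ↦ 𝔰.covDerivPairingForm A ψ φ y (𝔰.frame i k y)) x (𝔰.frame i k x) -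
        𝔰.covDerivPairingForm A ψ φ x (g.leviCivita (𝔰.frame i k) x (𝔰.frame i k x))) =
      ∑ k, (star (covDeriv A φ i x (𝔰.frame i k x)) ⬝ᵥ covDeriv A ψ i x (𝔰.frame i k x)).re -
        (star (φ.toFun i x) ⬝ᵥ 𝔰.localLaplacian A i (ψ.toFun i) x).re := by
  have hnhds := (𝔰.isOpen_baseSet i).mem_nhds hx
  have hs2 : ∀ a, ContMDiffAt (𝓡 4) 𝓘(ℝ, ℂ) 2 (fun y ↦ ψ.toFun i y a) x := fun a ↦
    ((hψ i a).of_le (inferInstance : ENat.LEInfty (2 : ℕ∞ω)).out).contMDiffAt hnhds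
  have hψd : SpinorMDiffAt (ψ.toFun i) x := hψ.spinorMDiffAt hx
  have hφd : SpinorMDiffAt (φ.toFun i) x := hφ.spinorMDiffAt hx
  have hWs : ∀ k, SpinorMDiffAt (fun y ↦ 𝔰.localCovDeriv A i (ψ.toFun i) y (𝔰.frame i k y)) x := fun k ↦
    𝔰.spinorMDiffAt_localCovDeriv_apply A hx hs2 (𝔰.contMDiffOn_frame_one i k)
  -- the derivative term, by the Leibniz rule for the pairing
  have hD : ∀ k, mvfderiv (𝓡 4) (fun y ↦ 𝔰.covDerivPairingForm A ψ φ y (𝔰.frame i k y)) x (𝔰.frame i k x) =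
      (star (𝔰.localCovDeriv A i (φ.toFun i) x (𝔰.frame i k x)) ⬝ᵥ 𝔰.localCovDeriv A i (ψ.toFun i) x (𝔰.frame i k x)).re +
        (star (φ.toFun i x) ⬝ᵥ 𝔰.localCovDeriv A i (fun y ↦ 𝔰.localCovDeriv A i (ψ.toFun i) y (𝔰.frame i k y)) x
          (𝔰.frame i k x)).re := by
    intro k
    have hev : (fun y ↦ 𝔰.covDerivPairingForm A ψ φ y (𝔰.frame i k y)) =ᶠ[𝓝 x]
        fun y ↦ (star (φ.toFun i y) ⬝ᵥ 𝔰.localCovDeriv A i (ψ.toFun i) y (𝔰.frame i k y)).re := by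
      filter_upwards [hnhds] with y hy
      rw [𝔰.covDerivPairingForm_apply_of_mem A hψ φ hy, 𝔰.covDeriv_eq_localCovDeriv]
    rw [Literature.Geometry.Lorentzian.mvfderiv_congr_nhds hev,
      mvfderiv_re_eq (mdifferentiableAt_star_dotProduct (hWs k) hφd),
      𝔰.complexDeriv_spinorPairing_eq A i (hWs k) hφd, Complex.add_re]
  -- the connection term
  have hC : ∀ k, 𝔰.covDerivPairingForm A ψ φ x (g.leviCivita (𝔰.frame i k) x (𝔰.frame i k x)) =
      (star (φ.toFun i x) ⬝ᵥ 𝔰.localCovDeriv A i (ψ.toFun i) x (g.leviCivita (𝔰.frame i k) x (𝔰.frame i k x))).re := fun k ↦ by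
    rw [𝔰.covDerivPairingForm_apply_of_mem A hψ φ hx, 𝔰.covDeriv_eq_localCovDeriv]
  simp only [hD, hC, localLaplacian, dotProduct_neg, Complex.neg_re, dotProduct_sum, Complex.re_sum, dotProduct_sub,
    Complex.sub_re, Finset.sum_sub_distrib, Finset.sum_add_distrib, 𝔰.covDeriv_eq_localCovDeriv]
  ring

end SpincStructure

end Literature.Geometry.GaugeTheory

end
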